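import Mathlib
import Summits.ValiantsHypothesis.ValiantsHypothesis.Theorems.AlgebraicKWGamesOneAlternationLowerBoundGeneric

/-!
# Bounded-alternation algebraic KW protocols for the permanent: the generic run (schedule-free core)

Support machinery for item `stmt-ValiantsHypothesis-10299`
(`Summit.ValiantsHypothesis.ValiantsHypothesis.Theses.AlgebraicKWGames.BoundedAlternationLowerBound`).

This is the schedule-free core of the generic-run method of
`AlgebraicKWGamesOneAlternationLowerBoundRun/Generic` (there the structure `OneAlt.Protocol` bakes in
the one-alternation schedule): `AltProtocol n T` bundles `(blk, msg, out)` and correctness only, with a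
MONOTONE block index `blk` (Alice speaks in round `t` iff `Even (blk t)`), and we re-derive for it the
generic messages `gen`, the soundness lemma `generic_output_ne`, and the Zariski step
(`zariski_step`).  In addition we record the *specialisation lemma*
`gen_insert_eq_subst_gen`: up to and including the first round whose generic message is killed by the
identification `y_e ↦ x_e`, the generic run on `insert e E` is the image of the run on `E`.

Honest framing: bookkeeping for a toy-model lower bound; nothing here bears on VP versus VNP.
-/

open MvPolynomial

-- the summit and the problem share the name `ValiantsHypothesis` (D-0017 single-conjunct layout)
set_option linter.dupNamespace false

namespace Summit.ValiantsHypothesis.ValiantsHypothesis.Theorems.AlgebraicKWGames.OneAlt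

open scoped Classical

noncomputable section

variable {n : ℕ}

/-- A zero-test algebraic protocol of depth `T` for the KW game of `per_n` with a monotone block
schedule `blk` (Alice speaks in round `t` iff `Even (blk t)`), together with its correctness — the data
and hypotheses quantified in the route statement `BoundedAlternationLowerBound` except the alternation
bound, which is kept as a separate hypothesis. -/
structure AltProtocol (n T : ℕ) : Type where
  /-- the block index of a round (Alice speaks in even blocks) -/
  blk : ℕ → ℕ
  /-- the message polynomial of round `t`, given the zero pattern of the earlier messages -/
  msg : (t : ℕ) → (Fin t → Bool) → MvPolynomial (Cell n ⊕ Fin t) ℂ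
  /-- the output cell, given the zero pattern of the `T` messages -/
  out : (Fin T → Bool) → Cell n
  /-- the block index is monotone -/
  mono : Monotone blk
  /-- correctness for the KW game of `per_n` -/
  correct : ∀ a b : Cell n → ℂ,
    MvPolynomial.eval a (Literature.Computability.AlgebraicComplexity.perPoly (Fin n) ℂ) ≠
      MvPolynomial.eval b (Literature.Computability.AlgebraicComplexity.perPoly (Fin n) ℂ) →
    ∀ (m : ℕ → ℂ) (z : ℕ → Bool), (∀ j, z j = true ↔ m j = 0) →
      (∀ t < T, m t = MvPolynomial.eval (Sum.elim (if Even (blk t) then a else b) (fun j : Fin t => m j))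
        (msg t (fun j : Fin t => z j))) →
      a (out (fun j : Fin T => z j)) ≠ b (out (fun j : Fin T => z j))

variable {T : ℕ} (P : AltProtocol n T)

namespace AltProtocol

/-- The speaker's own variables in round `t`: Alice (`Even (blk t)`) holds `x`, Bob holds `y`. -/
def vars (t : ℕ) (c : Cell n) : R n :=
  if Even (P.blk t) then X (Sum.inl c) else X (Sum.inr c)

/-- One step of the generic run on the subspace `E`. -/
def step (E : Finset (Cell n)) (t : ℕ) (q : Fin t → R n) : R n :=
  subst E (aeval (Sum.elim (P.vars t) q) (P.msg t (fun j => decide (q j = 0))))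

/-- The generic message polynomial of round `t` on the subspace `E` (strong recursion on `t`). -/
def gen (E : Finset (Cell n)) : ℕ → R n :=
  Nat.strongRec (fun t ih => P.step E t (fun j : Fin t => ih j j.2))

/-- Unfolding the strong recursion defining `gen`. -/
theorem gen_eq (E : Finset (Cell n)) (t : ℕ) :
    P.gen E t = P.step E t (fun j : Fin t => P.gen E j) := by
  rw [gen, Nat.strongRec_eq]
  rfl

/-- The generic zero pattern of round `j` on `E`. -/
def genPat (E : Finset (Cell n)) (j : ℕ) : Bool := decide (P.gen E j = 0)

/-- Generic messages on `E` are already identified on `E`. -/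
theorem subst_gen (E : Finset (Cell n)) (t : ℕ) : subst E (P.gen E t) = P.gen E t := by
  rw [gen_eq, step, subst_idem]

/-- `subst F` of a generic message on `E ⊆ F`, as a substitution instance of the same message
polynomial. -/
theorem subst_gen_eq_aeval {E F : Finset (Cell n)} (hEF : E ⊆ F) (t : ℕ) :
    subst F (P.gen E t) = aeval (Sum.elim (fun c => subst F (P.vars t c)) (fun j : Fin t =>
      subst F (P.gen E j))) (P.msg t (fun j : Fin t => P.genPat E j)) := by
  rw [gen_eq, step, subst_subst_of_subset hEF, ← AlgHom.comp_apply, comp_aeval]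
  have h : (fun i => subst F (Sum.elim (P.vars t) (fun j : Fin t => P.gen E j) i)) =
      Sum.elim (fun c => subst F (P.vars t c)) (fun j : Fin t => subst F (P.gen E j)) := by
    funext i
    rcases i with c | j <;> rfl
  exact congrArg (fun f => aeval f _) h

/-- The generic output cell on the subspace `E`. -/
def genOut (E : Finset (Cell n)) : Cell n := P.out (fun j : Fin T => P.genPat E j)

/-- **Soundness of the generic run** (as `OneAlt.Protocol.generic_output_ne`). -/
theorem generic_output_ne (E : Finset (Cell n)) (p : Var n → ℂ)
    (hpE : ∀ c ∈ E, p (Sum.inr c) = p (Sum.inl c))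
    (hgen : ∀ t < T, P.gen E t ≠ 0 → eval p (P.gen E t) ≠ 0)
    (hper : MvPolynomial.eval (fun c => p (Sum.inl c))
        (Literature.Computability.AlgebraicComplexity.perPoly (Fin n) ℂ) ≠
      MvPolynomial.eval (fun c => p (Sum.inr c))
        (Literature.Computability.AlgebraicComplexity.perPoly (Fin n) ℂ)) :
    p (Sum.inl (P.genOut E)) ≠ p (Sum.inr (P.genOut E)) := by
  set m : ℕ → ℂ := fun t => eval p (P.gen E t) with hm
  set z : ℕ → Bool := fun j => decide (m j = 0) with hz
  have hpat : ∀ j < T, P.genPat E j = z j := by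
    intro j hj
    simp only [genPat, hz, hm]
    by_cases h0 : P.gen E j = 0
    · simp [h0]
    · have := hgen j hj h0
      simp [h0, this]
  have hzT : (fun j : Fin T => P.genPat E j) = fun j : Fin T => z j := by
    funext j; exact hpat j j.2
  have key := P.correct (fun c => p (Sum.inl c)) (fun c => p (Sum.inr c)) hper m z
    (fun j => by simp [hz]) ?_
  · simpa [genOut, hzT] using key
  intro t ht
  have hzt : (fun j : Fin t => z j) = fun j : Fin t => P.genPat E j := by
    funext j; exact (hpat j (lt_trans j.2 ht)).symm
  rw [hzt]
  show eval p (P.gen E t) = _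
  rw [gen_eq, step, eval_subst_of_agree E p hpE, eval_aeval_eq]
  have hfun : (fun i => eval p (Sum.elim (P.vars t) (fun j : Fin t => P.gen E j) i)) =
      Sum.elim (if Even (P.blk t) then (fun c => p (Sum.inl c)) else fun c => p (Sum.inr c))
        (fun j : Fin t => m j) := by
    funext i
    rcases i with c | j
    · simp only [Sum.elim_inl, vars]
      split_ifs <;> simp
    · simp [hm]
  rw [hfun]
  rfl

/-! ## The Zariski step (schedule-free, as in `…OneAlternationLowerBoundGeneric`) -/

/-- The genericity polynomial of the subspace `E`. -/
def Phi (E : Finset (Cell n)) : R n :=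
  (∏ t ∈ (Finset.range T).filter (fun t => P.gen E t ≠ 0), P.gen E t) * subst E (perX - perY)

/-- If `F ⊇ E` contains the generic output cell of `E`, then `Phi E` vanishes identically after the
identification `subst F` (correctness at the generic points of the subspace `F`, then
`MvPolynomial.funext`). -/
theorem subst_Phi_eq_zero {E F : Finset (Cell n)} (hEF : E ⊆ F) (he : P.genOut E ∈ F) :
    subst F (P.Phi E) = 0 := by
  apply MvPolynomial.funext
  intro p
  rw [map_zero, ← eval_identify]
  by_contra hne
  set p' := identify F p with hp'
  rw [Phi, map_mul, map_prod] at hne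
  have hgen := Finset.prod_ne_zero_iff.mp (mul_ne_zero_iff.mp hne).1
  have hper := (mul_ne_zero_iff.mp hne).2
  have hpE : ∀ c ∈ E, p' (Sum.inr c) = p' (Sum.inl c) := fun c hc => identify_agree F p (hEF hc)
  have key := P.generic_output_ne E p' hpE
    (fun t ht h0 => hgen t (Finset.mem_filter.mpr ⟨Finset.mem_range.mpr ht, h0⟩)) ?_
  · exact key (identify_agree F p he).symm
  · rw [eval_subst_of_agree E p' hpE, map_sub, eval_perX, eval_perY, sub_ne_zero] at hper
    exact hper

/-- **Zariski step.**  If two cells are to spare, the generic output cell `e` of `E` is a new cell,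
and identifying it (`y_e ↦ x_e` on top of `E`) kills a nonzero generic message of a round `< T`. -/
theorem zariski_step (E : Finset (Cell n)) {e₀ : Cell n} (he₀ : e₀ ∉ E)
    (hroom : ∀ e, ∃ e₁, e₁ ∉ insert e E) :
    P.genOut E ∉ E ∧ ∃ t < T, P.gen E t ≠ 0 ∧ subst (insert (P.genOut E) E) (P.gen E t) = 0 := by
  have hnot : P.genOut E ∉ E := by
    intro he
    have hzero := P.subst_Phi_eq_zero subset_rfl he
    rw [Phi, map_mul, map_prod, subst_idem, mul_eq_zero, Finset.prod_eq_zero_iff] at hzero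
    rcases hzero with ⟨t, ht, h0⟩ | h0
    · rw [subst_gen] at h0
      exact (Finset.mem_filter.mp ht).2 h0
    · exact subst_perX_sub_perY_ne_zero E he₀ h0
  refine ⟨hnot, ?_⟩
  obtain ⟨e₁, he₁⟩ := hroom (P.genOut E)
  set F := insert (P.genOut E) E with hF
  have hzero := P.subst_Phi_eq_zero (Finset.subset_insert _ E) (Finset.mem_insert_self _ E)
  rw [Phi, map_mul, map_prod, subst_subst_of_subset (Finset.subset_insert _ E), mul_eq_zero,
    Finset.prod_eq_zero_iff] at hzero
  rcases hzero with ⟨t, ht, h0⟩ | h0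
  · obtain ⟨htT, hne⟩ := Finset.mem_filter.mp ht
    exact ⟨t, Finset.mem_range.mp htT, hne, h0⟩
  · exact (subst_perX_sub_perY_ne_zero F he₁ h0).elim

/-! ## The specialisation lemma -/

/-- **Specialisation.**  If no nonzero generic message on `E` of a round `< t` is killed by `subst F`
(`E ⊆ F`), then the generic messages on `F` of the rounds `≤ t` are the `subst F`-images of those
on `E`. -/
theorem gen_eq_subst_gen_of_not_killed {E F : Finset (Cell n)} (hEF : E ⊆ F) :
    ∀ t, (∀ j < t, ¬ (P.gen E j ≠ 0 ∧ subst F (P.gen E j) = 0)) → P.gen F t = subst F (P.gen E t) := by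
  intro t
  induction t using Nat.strong_induction_on with
  | _ t ih =>
    intro hnk
    have hprev : ∀ j : Fin t, P.gen F j = subst F (P.gen E j) := fun j =>
      ih j j.2 (fun j' hj' => hnk j' (lt_trans hj' j.2))
    have hpat : ∀ j : Fin t, P.genPat F j = P.genPat E j := by
      intro j
      have hj := hnk j j.2
      simp only [not_and] at hj
      simp only [genPat, hprev j]
      by_cases h0 : P.gen E j = 0
      · simp [h0]
      · simp [h0, hj h0]
    have h1 : (fun j : Fin t => P.genPat F j) = fun j : Fin t => P.genPat E j := funext hpat
    have h2 : (fun j : Fin t => subst F (P.gen F j)) = fun j : Fin t => subst F (P.gen E j) := by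
      funext j
      rw [hprev j, subst_idem]
    conv_lhs => rw [← P.subst_gen F t]
    rw [P.subst_gen_eq_aeval subset_rfl t, P.subst_gen_eq_aeval hEF t, h1, h2]

end AltProtocol

end

end Summit.ValiantsHypothesis.ValiantsHypothesis.Theorems.AlgebraicKWGames.OneAlt
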